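import Summits.QuantumFields.BalabanUV.T4Continuum.Support.GradedWellTwoLevel
import Summits.QuantumFields.BalabanUV.T4Continuum.Support.KingPairingPlantedLaw

/-!
# T⁴ programme, spine node NE2 (U1a), sub-row Δ1 — THE GRADED WELL, file 5: O15's TWO-LEVEL TRANSFER ON THE TORUS TOWER
# `‖G_GW′J − JG_GW‖ ≤ (1+κ)²·‖G̃′J − JG̃‖ + γ⁻²·(b·ki·εBt + (εB·ki + b·εK)·b)`, `κ = b²·ki·γ⁻¹` LEVEL-FREE, and
# `hinjK_GW_of_local` ⟸ (GW-L)(GW-B)(GW-Bᵗ)(GW-K) (owner item O16-d, part 2)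

Row NE2 OWNER (unit `b2b-balaban-t4-ne2-p1`, gen 16), on files 1–4.  This is `RegionGaugeResolventTower.opNorm_injected_le_of_local` /
`RegionGaugeResolventTowerRegion.hinjK_of_local_of_coercive` (gen 15, for the electric region member) RE-INSTANTIATED on the graded well:
the operator is `regionGW` ON THE TORUS, King's planting is `KingPairingPlantedLaw.JK (lev L k) L M` (‖J‖ ≤ 1), the gauge columns of
level `k+1` are indexed by the level-`k` scalar rows through `GradedWellTwoLevel.rowSLift` (`BhGWL`, `KGWL`), and — the point of R47 — the
rank of the sandwich (`#RowS`) and the constant `κ = ‖E·G‖ ≤ b²·ki·γ⁻¹` are LEVEL-FREE once `γ` (coercivity of `regionGW`, ⟸ (GW-W1) + the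
scalar bound by `GradedWellSlice.coercive_regionGW_of_slice`), `b` (‖B‖) and `ki` (‖K⁻¹‖, ⟸ (GW-K)'s normalisation) are: no wall, no `n²`
sandwich (the two numerics desks measure ‖E‖ SATURATING and κ decelerating on GW₂, journal l.25267).

 * §1 **`opNorm_injected_le_of_local_GW`** (two levels `k`, `k+1`, `m ≤ k`): the faithful injected defect from (L) `εloc` = the LOCAL
   injected defect (`localGW = LapV + a•QvGWᴴQvGW`, componentwise), (B) `εB = ‖B′ − JB‖`, (Bᵗ) `εBt = ‖JᴴB′ − B‖`, (K) `εK = ‖K′⁻¹ − K⁻¹‖`.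
 * §2 **`hinjK_GW_of_local`**: along the tower (`k ≥ m`), leaves at rate `θ` ⟹ `‖G_{k+1}J_k − J_kG_k‖ ≤ C1GW·θ^k`,
   `C1GW = (1+κ)²·Cl + γ⁻²·(b·ki·Cbt + (Cb·ki + b·Ck)·b)`.
 * §3 the CHEAP level-free half of (GW-B): `nsq_gradT_le_form_DpGW`, **`opNorm_BhGW_le : ‖B_k‖ ≤ √‖G′_GW‖`**, `opNorm_BhGWL_le`.

HONEST FRAMING (T4-DAG p. 1).  [folklore] bookkeeping over landed modules (model level: `U = 1`, one layer map on unit blocks, `m` fixed, finite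
torus, operator norm); `γ`, `b`, `ki` and the four leaves are DISPLAYED, not proved; no `TowerLimitRate` yet ((GW-A) assembles it); NE2 (U1a)
NOT proved; spine PROVED 0/9 unchanged; NOT [B9] (3.16)/(3.23)–(3.27)/(3.42) as printed; NOT infinite volume / mass gap / Clay.  HONEST DEPENDENCY:
continuum YM on T⁴ ⇐ BetaPertH ∧ nine spine estimates (0/9 proved); BetaPertH ⇐ (D1) ∧ (D4) ∧ CAP+tail; G-an2-4 gates asym, D1 and NE2/3/4.
No `sorry`.
-/

noncomputable section

open scoped BigOperators ComplexConjugate Matrix Matrix.Norms.L2Operator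

namespace Summit.QuantumFields.BalabanUV.T4Continuum.GradedWellResolventTower

open Literature.MathematicalPhysics.QuantumFieldTheory.Balaban1983to89.B5Prop11Plancherel (Tor fine)
open Literature.MathematicalPhysics.QuantumFieldTheory.Balaban1983to89.B5G183RateUnitTower (lev lev_neZero)
open Literature.MathematicalPhysics.QuantumFieldTheory.Balaban1983to89 (B5Prop11Lower.nsq B5Prop11Lower.nsq_nonneg B5Action121.GradOp_conjTranspose_mul_GradOp)
open Summit.QuantumFields.BalabanUV.T4Continuum
open Summit.QuantumFields.BalabanUV.T4Continuum.SubtypeCompression (Coercive isUnit_det_of_coercive opNorm_inv_le_of_coercive)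
open Summit.QuantumFields.BalabanUV.T4Continuum.KingPairingPlantedLaw (JK opNorm_JK_le)
open Summit.QuantumFields.BalabanUV.T4Continuum.RegionGaugeResolventSplit (opNorm_injected_le_split opNorm_sandwich_comm_le)
open Summit.QuantumFields.BalabanUV.T4Continuum.GradedWellData
open Summit.QuantumFields.BalabanUV.T4Continuum.GradedWellTwoLevel

variable {d : ℕ} (L : ℕ) [NeZero L] (M : Fin d → ℕ) [hM : ∀ μ, NeZero (M μ)] (k m : ℕ) (layer : Tor M → ℕ) (a a' : ℝ)

/-! ## §1 Two levels -/

/-- King's planting from level `k` to level `k+1` on the torus bond space (‖J‖ ≤ 1, `JᴴJ = 1`). [cite: King1986, (2.10) p.653 (shape)] [folklore] -/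
abbrev JGW : Matrix (TorK L M (k + 1) × Fin d) (TorK L M k × Fin d) ℂ := JK (lev L k) L M

/-- the gauge sandwich `E_k = B_k·K_k⁻¹·B_kᴴ` is bounded by `b²·ki`. [folklore] -/
theorem opNorm_sandwich_le {v u : Type*} [Fintype v] [DecidableEq v] [Fintype u] [DecidableEq u] (B : Matrix v u ℂ) (K : Matrix u u ℂ)
    {b ki : ℝ} (hb : ‖B‖ ≤ b) (hki : ‖K⁻¹‖ ≤ ki) (hb0 : 0 ≤ b) (hki0 : 0 ≤ ki) : ‖B * K⁻¹ * Bᴴ‖ ≤ b * ki * b := by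
  have hBt : ‖Bᴴ‖ ≤ b := by rw [Matrix.l2_opNorm_conjTranspose]; exact hb
  calc ‖B * K⁻¹ * Bᴴ‖ ≤ ‖B * K⁻¹‖ * ‖Bᴴ‖ := Matrix.l2_opNorm_mul _ _
    _ ≤ ‖B‖ * ‖K⁻¹‖ * ‖Bᴴ‖ := mul_le_mul_of_nonneg_right (Matrix.l2_opNorm_mul _ _) (norm_nonneg _)
    _ ≤ b * ki * b := by gcongr

/-- **O15's TRANSFER ON THE GRADED WELL, TWO LEVELS** (`m ≤ k`; `regionGW` `γ`-coercive at both levels; `K` invertible at both levels with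
`‖K⁻¹‖ ≤ ki`; gauge columns bounded by `b`): the faithful injected defect from the LOCAL one and the two-level convergence of the gauge data,
`‖G′J − JG‖ ≤ (1+κ)·εloc·(1+κ) + γ⁻¹·(b·ki·εBt + (εB·ki + b·εK)·b)·γ⁻¹`, `κ = b·ki·b·γ⁻¹` — LEVEL-FREE in the level-free data. [folklore] -/
theorem opNorm_injected_le_of_local_GW (hk : m ≤ k) {γ b ki : ℝ} (hγ : 0 < γ) (hb0 : 0 ≤ b) (hki0 : 0 ≤ ki)
    (hco : Coercive (regionGW L M k m layer a a') γ) (hco' : Coercive (regionGW L M (k + 1) m layer a a') γ)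
    (hK : IsUnit (KGW L M k m layer a').det) (hK' : IsUnit (KGW L M (k + 1) m layer a').det)
    (hb : ‖BhGW L M k m layer a'‖ ≤ b) (hb' : ‖BhGWL L M k m layer a' hk‖ ≤ b)
    (hki : ‖(KGW L M k m layer a')⁻¹‖ ≤ ki) (hki' : ‖(KGWL L M k m layer a' hk)⁻¹‖ ≤ ki)
    {εloc εB εBt εK : ℝ} (hεB : 0 ≤ εB)
    (hloc : ‖(localGW L M (k + 1) m layer a)⁻¹ * JGW L M k - JGW L M k * (localGW L M k m layer a)⁻¹‖ ≤ εloc)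
    (hB : ‖BhGWL L M k m layer a' hk - JGW L M k * BhGW L M k m layer a'‖ ≤ εB)
    (hBt : ‖(JGW L M k)ᴴ * BhGWL L M k m layer a' hk - BhGW L M k m layer a'‖ ≤ εBt)
    (hKε : ‖(KGWL L M k m layer a' hk)⁻¹ - (KGW L M k m layer a')⁻¹‖ ≤ εK) :
    ‖(regionGW L M (k + 1) m layer a a')⁻¹ * JGW L M k - JGW L M k * (regionGW L M k m layer a a')⁻¹‖
      ≤ (1 + b * ki * b * γ⁻¹) * εloc * (1 + b * ki * b * γ⁻¹) + γ⁻¹ * (b * ki * εBt + (εB * ki + 1 * b * εK) * b) * γ⁻¹ := by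
  -- invertibility of the faithful and local operators at both levels
  have hX := isUnit_det_of_coercive hγ hco
  have hX' := isUnit_det_of_coercive hγ hco'
  have hKg : IsUnit (RegionGaugeProjection.gramK (GOmGW L M k m layer a') (GradedWellSlice.QsGWn L M k m layer)).det := hK
  have hKg' : IsUnit (RegionGaugeProjection.gramK (GOmGW L M (k + 1) m layer a') (GradedWellSlice.QsGWn L M (k + 1) m layer)).det := hK'
  have hcoL : Coercive (localGW L M k m layer a) γ := by
    have h := GradedWellSlice.regionGW_eq_normalised L M k m layer a a'
    intro A
    have h1 := hco A
    rw [h] at h1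
    exact h1.trans (RegionGaugeResolventSplit.form_gaugeFixed_le_form_localFixed _ _ _ _ _ _
      (GOmGW_isHermitian L M k m layer a') hKg A)
  have hcoL' : Coercive (localGW L M (k + 1) m layer a) γ := by
    have h := GradedWellSlice.regionGW_eq_normalised L M (k + 1) m layer a a'
    intro A
    have h1 := hco' A
    rw [h] at h1
    exact h1.trans (RegionGaugeResolventSplit.form_gaugeFixed_le_form_localFixed _ _ _ _ _ _
      (GOmGW_isHermitian L M (k + 1) m layer a') hKg' A)
  have hY := isUnit_det_of_coercive hγ hcoL
  have hY' := isUnit_det_of_coercive hγ hcoL'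
  have hg : ‖(regionGW L M k m layer a a')⁻¹‖ ≤ γ⁻¹ := opNorm_inv_le_of_coercive hγ hco
  have hg' : ‖(regionGW L M (k + 1) m layer a a')⁻¹‖ ≤ γ⁻¹ := opNorm_inv_le_of_coercive hγ hco'
  -- the sandwiches are bounded by `b·ki·b`, hence `‖E·G‖, ‖G′·E′‖ ≤ b·ki·b·γ⁻¹`
  have hE := opNorm_sandwich_le (BhGW L M k m layer a') (KGW L M k m layer a') hb hki hb0 hki0
  have hE' := opNorm_sandwich_le (BhGWL L M k m layer a' hk) (KGWL L M k m layer a' hk) hb' hki' hb0 hki0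
  have h0 : 0 ≤ b * ki * b := mul_nonneg (mul_nonneg hb0 hki0) hb0
  have hκ : ‖BhGW L M k m layer a' * (KGW L M k m layer a')⁻¹ * (BhGW L M k m layer a')ᴴ * (regionGW L M k m layer a a')⁻¹‖
      ≤ b * ki * b * γ⁻¹ :=
    (Matrix.l2_opNorm_mul _ _).trans (mul_le_mul hE hg (norm_nonneg _) h0)
  have hκ' : ‖(regionGW L M (k + 1) m layer a a')⁻¹
      * (BhGWL L M k m layer a' hk * (KGWL L M k m layer a' hk)⁻¹ * (BhGWL L M k m layer a' hk)ᴴ)‖ ≤ b * ki * b * γ⁻¹ := by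
    refine (Matrix.l2_opNorm_mul _ _).trans ?_
    rw [mul_comm (b * ki * b) γ⁻¹]
    exact mul_le_mul hg' hE' (norm_nonneg _) (inv_nonneg.mpr hγ.le)
  have h1 := opNorm_injected_le_split hX hY (regionGW_eq_localGW_sub_sandwich' L M k m layer a a') hX' hY'
    (regionGW_succ_eq_localGW_sub_sandwichL L M k m layer a a' hk) (JGW L M k) hκ hκ' hg hg' (inv_nonneg.mpr hγ.le)
  have h2 := opNorm_sandwich_comm_le (BhGW L M k m layer a') (BhGWL L M k m layer a' hk) ((KGW L M k m layer a')⁻¹)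
    ((KGWL L M k m layer a' hk)⁻¹) (JGW L M k) hb hb' hki' (opNorm_JK_le (lev L k) L M) hB hBt hKε hb0 hb0 hki0 zero_le_one hεB
  have hκ0 : 0 ≤ 1 + b * ki * b * γ⁻¹ := by have := mul_nonneg h0 (inv_nonneg.mpr hγ.le); linarith
  calc ‖(regionGW L M (k + 1) m layer a a')⁻¹ * JGW L M k - JGW L M k * (regionGW L M k m layer a a')⁻¹‖
      ≤ (1 + b * ki * b * γ⁻¹) * ‖(localGW L M (k + 1) m layer a)⁻¹ * JGW L M k - JGW L M k * (localGW L M k m layer a)⁻¹‖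
            * (1 + b * ki * b * γ⁻¹)
          + γ⁻¹ * ‖BhGWL L M k m layer a' hk * (KGWL L M k m layer a' hk)⁻¹ * (BhGWL L M k m layer a' hk)ᴴ * JGW L M k
              - JGW L M k * (BhGW L M k m layer a' * (KGW L M k m layer a')⁻¹ * (BhGW L M k m layer a')ᴴ)‖ * γ⁻¹ := h1
    _ ≤ (1 + b * ki * b * γ⁻¹) * εloc * (1 + b * ki * b * γ⁻¹) + γ⁻¹ * (b * ki * εBt + (εB * ki + 1 * b * εK) * b) * γ⁻¹ := by
          gcongr

/-! ## §2 Along the tower -/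

/-- the two-level constant of the faithful graded-well tower from the four leaf constants and the level-free data `γ`, `b`, `ki`. [folklore] -/
def C1GW (γ b ki Cl Cb Cbt Ck : ℝ) : ℝ :=
  (1 + b * ki * b * γ⁻¹) * Cl * (1 + b * ki * b * γ⁻¹) + γ⁻¹ * (b * ki * Cbt + (Cb * ki + 1 * b * Ck) * b) * γ⁻¹

/-- **`hinjK` FOR THE GRADED WELL FROM THE FOUR LEAVES AT RATE `θ`** (levels `k ≥ m`; `γ`, `b`, `ki` level-free; `0 ≤ θ`):
(GW-L) the injected law of the LOCAL operator, (GW-B)/(GW-Bᵗ) two-level convergence of the gauge columns, (GW-K) of `K⁻¹` ⟹ King's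
injected law of the faithful `regionGW` with constant `C1GW`. [folklore] -/
theorem hinjK_GW_of_local {γ b ki θ Cl Cb Cbt Ck : ℝ} (hγ : 0 < γ) (hb0 : 0 ≤ b) (hki0 : 0 ≤ ki) (hθ : 0 ≤ θ) (hCb : 0 ≤ Cb)
    (hco : ∀ k, m ≤ k → Coercive (regionGW L M k m layer a a') γ)
    (hK : ∀ k, m ≤ k → IsUnit (KGW L M k m layer a').det)
    (hb : ∀ k, m ≤ k → ‖BhGW L M k m layer a'‖ ≤ b)
    (hbL : ∀ k (hk : m ≤ k), ‖BhGWL L M k m layer a' hk‖ ≤ b)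
    (hki : ∀ k, m ≤ k → ‖(KGW L M k m layer a')⁻¹‖ ≤ ki)
    (hkiL : ∀ k (hk : m ≤ k), ‖(KGWL L M k m layer a' hk)⁻¹‖ ≤ ki)
    (hloc : ∀ k, m ≤ k → ‖(localGW L M (k + 1) m layer a)⁻¹ * JGW L M k - JGW L M k * (localGW L M k m layer a)⁻¹‖ ≤ Cl * θ ^ k)
    (hB : ∀ k (hk : m ≤ k), ‖BhGWL L M k m layer a' hk - JGW L M k * BhGW L M k m layer a'‖ ≤ Cb * θ ^ k)
    (hBt : ∀ k (hk : m ≤ k), ‖(JGW L M k)ᴴ * BhGWL L M k m layer a' hk - BhGW L M k m layer a'‖ ≤ Cbt * θ ^ k)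
    (hKε : ∀ k (hk : m ≤ k), ‖(KGWL L M k m layer a' hk)⁻¹ - (KGW L M k m layer a')⁻¹‖ ≤ Ck * θ ^ k)
    (k : ℕ) (hk : m ≤ k) :
    ‖(regionGW L M (k + 1) m layer a a')⁻¹ * JGW L M k - JGW L M k * (regionGW L M k m layer a a')⁻¹‖
      ≤ C1GW γ b ki Cl Cb Cbt Ck * θ ^ k := by
  have hθk : 0 ≤ θ ^ k := pow_nonneg hθ k
  have hk' : m ≤ k + 1 := Nat.le_succ_of_le hk
  have h := opNorm_injected_le_of_local_GW L M k m layer a a' hk hγ hb0 hki0 (hco k hk) (hco (k + 1) hk') (hK k hk) (hK (k + 1) hk')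
    (hb k hk) (hbL k hk) (hki k hk) (hkiL k hk) (mul_nonneg hCb hθk) (hloc k hk) (hB k hk) (hBt k hk) (hKε k hk)
  refine h.trans (le_of_eq ?_)
  unfold C1GW
  ring


/-! ## §3 The cheap level-free bound on the gauge columns: `‖B_k‖ ≤ √‖G′_GW‖` -/

/-- `‖∂ψ‖² ≤ Re⟨ψ, Δ′_GW ψ⟩` (`0 ≤ a′`): the gradient energy is dominated by the graded scalar form. [folklore] -/
theorem nsq_gradT_le_form_DpGW (ha' : 0 ≤ a') (ψ : TorK L M k → ℂ) :
    B5Prop11Lower.nsq (gradT L M k *ᵥ ψ) ≤ (star ψ ⬝ᵥ (DpGW L M k m layer a' *ᵥ ψ)).re := by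
  unfold DpGW
  rw [← B5Action121.GradOp_conjTranspose_mul_GradOp, Matrix.add_mulVec, dotProduct_add, Complex.add_re,
    RegionGaugeSlice.form_gram, Complex.ofReal_re, Matrix.smul_mulVec, dotProduct_smul, RegionGaugeSlice.form_gram, smul_eq_mul,
    ← Complex.ofReal_mul, Complex.ofReal_re]
  have := mul_nonneg ha' (B5Prop11Lower.nsq_nonneg (QsGWw L M k m layer *ᵥ ψ))
  linarith

/-- **`‖B_k‖ ≤ √‖G′_GW‖`** (given `Δ′_GW` invertible and `0 ≤ a′`): the gauge columns of the graded well are energy-bounded, LEVEL-FREE in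
`‖G′_GW‖` — the `b` of §1/§2 is `√g` for any level-free bound `‖GOmGW‖ ≤ g` ((GW-S0)). [folklore] -/
theorem opNorm_BhGW_le (ha' : 0 ≤ a') (hD : IsUnit (DpGW L M k m layer a').det) :
    ‖BhGW L M k m layer a'‖ ≤ Real.sqrt ‖GOmGW L M k m layer a'‖ := by
  have hDG : DpGW L M k m layer a' * GOmGW L M k m layer a' = 1 := Matrix.mul_nonsing_inv _ hD
  refine ScalarAveragedPropagator.opNorm_le_of_nsq_le_rect _ (Real.sqrt_nonneg _) fun c => ?_
  have h := RegionGaugeResolventSplit.nsq_gaugeB_mulVec_le (gradT L M k) (GOmGW L M k m layer a')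
    (GradedWellSlice.QsGWn L M k m layer) hDG (nsq_gradT_le_form_DpGW L M k m layer a' ha')
    (θ := 1) (by rw [GradedWellSlice.QsGWn_mul_conjTranspose, Complex.ofReal_one, one_smul]) c
  rw [Real.sq_sqrt (norm_nonneg _)]
  unfold BhGW
  linarith

/-- the same bound for the level-`k`-indexed columns of level `k+1` (a column permutation does not change the norm bound). [folklore] -/
theorem opNorm_BhGWL_le (hk : m ≤ k) (ha' : 0 ≤ a') (hD : IsUnit (DpGW L M (k + 1) m layer a').det) :
    ‖BhGWL L M k m layer a' hk‖ ≤ Real.sqrt ‖GOmGW L M (k + 1) m layer a'‖ := by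
  have h := opNorm_BhGW_le L M (k + 1) m layer a' ha' hD
  refine ScalarAveragedPropagator.opNorm_le_of_nsq_le_rect _ (Real.sqrt_nonneg _) fun c => ?_
  have e : BhGWL L M k m layer a' hk *ᵥ c
      = BhGW L M (k + 1) m layer a' *ᵥ (fun q => c ((rowSLift L M k m layer hk).symm q)) := by
    unfold BhGWL
    funext b
    simp only [Matrix.mulVec, dotProduct, Matrix.submatrix_apply, id]
    exact (Equiv.sum_comp (rowSLift L M k m layer hk) (fun q => BhGW L M (k + 1) m layer a' b q
      * c ((rowSLift L M k m layer hk).symm q))).symm.trans (by simp) |>.symm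
  rw [e]
  have h1 := BalabanBlockPoincare.nsq_mulVec_le_rect (BhGW L M (k + 1) m layer a') (fun q => c ((rowSLift L M k m layer hk).symm q))
  have h2 : B5Prop11Lower.nsq (fun q => c ((rowSLift L M k m layer hk).symm q)) = B5Prop11Lower.nsq c := by
    unfold B5Prop11Lower.nsq
    exact Equiv.sum_comp (rowSLift L M k m layer hk).symm (fun p => ‖c p‖ ^ 2)
  rw [h2] at h1
  have h3 : ‖BhGW L M (k + 1) m layer a'‖ ^ 2 ≤ Real.sqrt ‖GOmGW L M (k + 1) m layer a'‖ ^ 2 :=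
    pow_le_pow_left₀ (norm_nonneg _) h 2
  exact h1.trans (mul_le_mul_of_nonneg_right h3 (B5Prop11Lower.nsq_nonneg _))

end Summit.QuantumFields.BalabanUV.T4Continuum.GradedWellResolventTower

end
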